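import Summits.QuantumFields.YangMills.Theorems.ContinuumLegGivenGap.Negative.FrozenXiFatal
import HarnessLib

/-!
# `ContinuumLegGivenGap` (stmt-QuantumFields-15828) — negative side, sequel of `FrozenXiFatal`: frozen along a
# SUBSEQUENCE is already fatal; a tame non-trivial witness is EVENTUALLY unfrozen

Support file for the crux item stmt-QuantumFields-15828 (shared decl `ContinuumLegGivenGap`), namespace
`…Theorems.ContinuumLegGivenGap.Negative`. Sharpens `Negative/FrozenXiFatal.lean`:

* `tendsto_latticeTrunc_diag` — under `IsYangMillsFor`, the truncated lattice diagonal of any real positive-time test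
  function converges to `Re T(w,w)` (factored out of `not_isNontrivial_of_frozenXi`);
* `not_isNontrivial_of_frequently_frozenXi` — the frozen clustering bound need only hold at INFINITELY MANY steps
  (`∃ᶠ k`, not `∀ᶠ k`) to kill a sub-exponentially renormalised witness;
* `eventually_unfrozen_of_isNontrivial` — contrapositive: for a tame non-trivial witness every frozen bound fails
  for ALL large `k`: the lattice correlation length of the channel DIVERGES along the full sequence of couplings;
* `continuumLegGivenGap_witness_xi_diverges` — the same read off `SmallCircleAnchor.ContinuumLegGivenGap` BY NAME:
  sequential criticality at the witness's couplings (the scheme-level form of `DirichletWindow.XiDiverges`) is content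
  of the crux for every tamely renormalised witness.

Tree only (`FrozenXiFatal`, `FrozenXiFatalLattice`, `TruncatedOSForm`). References (context): K. Osterwalder,
R. Schrader, CMP 31 (1973) §4.1; J. Glimm, A. Jaffe, *Quantum Physics* (1987) Thm. 6.1.3. No definitions, no named
facts.
-/

noncomputable section

open scoped SchwartzMap
open MeasureTheory Filter Topology
open Literature.MathematicalPhysics.AQFT Literature.MathematicalPhysics.QuantumLattice
open Literature.MathematicalPhysics.QuantumFieldTheory
open Literature.Probability.LatticeModels (Site)
open Summit.QuantumFields.YangMills.Theorems.HypercubicLimit.Negative (osTrunc tensor₁ tensor₂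
  isTensorOf_tensor₁ isTensorOf_tensor₂ isOffDiagonal_of_halfSpaces twoPointNontrivial_iff_diagonal osTrunc_thetaTest
  tsupport_thetaTest_neg)

namespace Summit.QuantumFields.YangMills.Theorems.ContinuumLegGivenGap.Negative

/-! ## Frozen along a subsequence; eventual unfreezing -/

section Subsequence

variable {G : Type} [Group G] [TopologicalSpace G] [IsTopologicalGroup G] [CompactSpace G]
  [MeasurableSpace G] [BorelSpace G]

/-- **The truncated lattice diagonal of a positive-time real test function converges to `Re T(w,w)`** under the
convergence clause `IsYangMillsFor` (the real off-diagonal tensor `θw ⊗ w` and the two one-point tensors), factored out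
of `not_isNontrivial_of_frozenXi` for re-use. [folklore] -/
theorem tendsto_latticeTrunc_diag (r : LatticeRep G) (sch : SpeciesScheme (YMSpecies G)) (s : YMSpecies G)
    (T : OSData (YMSpecies G) 4) (hYM : IsYangMillsFor r sch T) {w : 𝓢(EuclideanSpace ℝ (Fin 4), ℝ)}
    (hw : tsupport (w : EuclideanSpace ℝ (Fin 4) → ℝ) ⊆ {y | 0 < y 0}) :
    Tendsto (fun k =>
      latticeSchwinger r.ρ sch (fun s => s.F) k (1 + 1) (fun _ => s) ![thetaTest 4 w, w] -
        latticeSchwinger r.ρ sch (fun s => s.F) k 1 (fun _ => s) ![thetaTest 4 w] *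
          latticeSchwinger r.ρ sch (fun s => s.F) k 1 (fun _ => s) ![w]) atTop
      (𝓝 (osTrunc T.schwinger s w w).re) := by
  have hu : tsupport (thetaTest 4 w : EuclideanSpace ℝ (Fin 4) → ℝ) ⊆ {y | y 0 < 0} := tsupport_thetaTest_neg hw
  set D : ℕ → ℝ := fun k =>
    latticeSchwinger r.ρ sch (fun s => s.F) k (1 + 1) (fun _ => s) ![thetaTest 4 w, w] -
      latticeSchwinger r.ρ sch (fun s => s.F) k 1 (fun _ => s) ![thetaTest 4 w] *
        latticeSchwinger r.ρ sch (fun s => s.F) k 1 (fun _ => s) ![w] with hD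
  have h2 := hYM (1 + 1) (by norm_num) (fun _ => s) ![thetaTest 4 w, w] (tensor₂ (thetaTest 4 w) w)
    (isTensorOf_tensor₂ _ _) (isOffDiagonal_of_halfSpaces hu hw (isTensorOf_tensor₂ _ _))
  have hu1 := hYM 1 one_ne_zero (fun _ => s) ![thetaTest 4 w] (tensor₁ (thetaTest 4 w)) (isTensorOf_tensor₁ _)
    (fun x hx => by obtain ⟨i, j, hij, -⟩ := hx; exact absurd (Subsingleton.elim i j) hij)
  have hv1 := hYM 1 one_ne_zero (fun _ => s) ![w] (tensor₁ w) (isTensorOf_tensor₁ _)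
    (fun x hx => by obtain ⟨i, j, hij, -⟩ := hx; exact absurd (Subsingleton.elim i j) hij)
  have hT0 : osTrunc T.schwinger s w w = T.schwinger (1 + 1) (fun _ => s) (tensor₂ (thetaTest 4 w) w) -
      T.schwinger 1 (fun _ => s) (tensor₁ (thetaTest 4 w)) * T.schwinger 1 (fun _ => s) (tensor₁ w) := by
    have h := osTrunc_thetaTest T.schwinger s (thetaTest 4 w) w
    rwa [thetaTest_involutive 4 w] at h
  have hT : Tendsto (fun k => (D k : ℂ)) atTop (𝓝 (osTrunc T.schwinger s w w)) := by
    rw [hT0]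
    exact (h2.sub (hu1.mul hv1)).congr fun k => by simp only [hD]; push_cast; ring
  have := (Complex.continuous_re.tendsto _).comp hT
  simpa [Function.comp_def] using this

/-- **Frozen along a subsequence is already fatal.** The hypothesis of `not_isNontrivial_of_frozenXi` can be weakened
from "eventually in `k`" to "FREQUENTLY in `k`": if the frozen bound `|corr_k(s, s ∘ τ_z; n)| ≤ C e^{-μ n}`
(`z⁰ = 0`, `n ≤ L_k`) holds at infinitely many steps of a scheme tied to `T`, and `s` is sub-exponentially
renormalised, then `T` is trivial in `s` (the truncated lattice diagonal of a sharp witness tends to `Re T(w,w) > 0`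
but is `≤ K e^{-μt/a_k} → 0` along the frozen subsequence). [folklore] -/
theorem not_isNontrivial_of_frequently_frozenXi (r : LatticeRep G) (sch : SpeciesScheme (YMSpecies G))
    (s : YMSpecies G) (T : OSData (YMSpecies G) 4) (hYM : IsYangMillsFor r sch T)
    (hfrozen : ∃ μ C : ℝ, 0 < μ ∧ ∃ᶠ k in atTop, ∀ (z : Site 4) (n : ℕ), z 0 = 0 → n ≤ sch.L k →
      |latticeConnectedCorr r.ρ (sch.β k) (2 * sch.L k + 1) s.F (s.F ∘ configShift z) n| ≤
        C * Real.exp (-(μ * n)))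
    (hc : ∀ ε : ℝ, 0 < ε → ∀ᶠ k in atTop, |sch.c s k| ≤ Real.exp (ε * (sch.a k)⁻¹)) :
    ¬ T.IsNontrivial s := by
  intro hnt
  obtain ⟨μ, C, hμ, hfro⟩ := hfrozen
  have hOS : OSReconstructionNoE1 T.schwinger := OSReconstructionNoE1.of_osAxioms T.osAxioms
  obtain ⟨v, hv, hpos⟩ := (twoPointNontrivial_iff_diagonal hOS T.normalized s).1 hnt
  obtain ⟨w, t, R₀, Mw, ht, hR₀, hmargin, hball, hMw, hwpos⟩ := exists_sharp_witness T.schwinger s hv hpos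
  have hw : tsupport (w : EuclideanSpace ℝ (Fin 4) → ℝ) ⊆ {y | 0 < y 0} :=
    fun y hy => lt_of_lt_of_le ht (hmargin hy)
  have hre := tendsto_latticeTrunc_diag r sch s T hYM hw
  set ℓ : ℝ := (osTrunc T.schwinger s w w).re with hℓ
  set D : ℕ → ℝ := fun k =>
    latticeSchwinger r.ρ sch (fun s => s.F) k (1 + 1) (fun _ => s) ![thetaTest 4 w, w] -
      latticeSchwinger r.ρ sch (fun s => s.F) k 1 (fun _ => s) ![thetaTest 4 w] *
        latticeSchwinger r.ρ sch (fun s => s.F) k 1 (fun _ => s) ![w] with hD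
  have hC0 : 0 ≤ C := by
    obtain ⟨k, hk⟩ := hfro.exists
    have h0 : (0 : ℝ) ≤ C * Real.exp (-(μ * ((0 : ℕ) : ℝ))) := (abs_nonneg _).trans (hk 0 0 rfl (Nat.zero_le _))
    simpa using h0
  have hainv : Tendsto (fun k => (sch.a k)⁻¹) atTop atTop :=
    tendsto_inv_nhdsGT_zero.comp
      (tendsto_nhdsWithin_iff.2 ⟨sch.tendsto_a, Eventually.of_forall fun k => sch.a_pos k⟩)
  set K₀ : ℝ := (2 * R₀ + 1) ^ 8 * Mw ^ 2 * C with hK₀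
  have hMw0 : 0 ≤ Mw := (abs_nonneg _).trans (hMw 0)
  have hK0 : 0 ≤ K₀ := by positivity
  have hev : ∀ᶠ k in atTop, sch.a k ≤ 1 ∧ 2 * R₀ ≤ sch.a k * sch.L k :=
    ((sch.tendsto_a.eventually (gt_mem_nhds one_pos)).mono fun k hk => hk.le).and
      (sch.tendsto_L.eventually_ge_atTop (2 * R₀))
  -- along the frozen subsequence the diagonal is small …
  have hbound : ∃ᶠ k in atTop, |D k| ≤ K₀ * Real.exp (-(μ * t * (sch.a k)⁻¹)) := by
    refine (hfro.and_eventually (hev.and (hc _ (by positivity : 0 < μ * t / 2)))).mono ?_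
    rintro k ⟨hfk, hk, hck⟩
    have hmain := abs_latticeTrunc_le_of_frozen r sch s hμ hC0 ht hR₀ hmargin hball hMw k hk.1 hk.2 hfk
    have hc2 : sch.c s k ^ 2 ≤ Real.exp (μ * t * (sch.a k)⁻¹) := by
      have habs : |sch.c s k| ^ 2 ≤ Real.exp (μ * t / 2 * (sch.a k)⁻¹) ^ 2 :=
        pow_le_pow_left₀ (abs_nonneg _) hck 2
      rw [sq_abs, sq (Real.exp _), ← Real.exp_add] at habs
      convert habs using 2
      ring
    calc |D k| ≤ sch.c s k ^ 2 * K₀ * Real.exp (-(2 * μ * t * (sch.a k)⁻¹)) := hmain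
      _ ≤ Real.exp (μ * t * (sch.a k)⁻¹) * K₀ * Real.exp (-(2 * μ * t * (sch.a k)⁻¹)) := by gcongr
      _ = K₀ * Real.exp (-(μ * t * (sch.a k)⁻¹)) := by
          rw [mul_comm (Real.exp _) K₀, mul_assoc, ← Real.exp_add]
          congr 2
          ring
  have hlim : Tendsto (fun k => K₀ * Real.exp (-(μ * t * (sch.a k)⁻¹))) atTop (𝓝 0) := by
    have h1 : Tendsto (fun k => -(μ * t * (sch.a k)⁻¹)) atTop atBot :=
      tendsto_neg_atTop_atBot.comp (hainv.const_mul_atTop (by positivity : 0 < μ * t))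
    simpa using (Real.tendsto_exp_atBot.comp h1).const_mul K₀
  -- … while it tends to `ℓ > 0`
  have h1 : ∀ᶠ k in atTop, ℓ / 2 < D k := hre.eventually (lt_mem_nhds (half_lt_self hwpos))
  have h2 : ∀ᶠ k in atTop, K₀ * Real.exp (-(μ * t * (sch.a k)⁻¹)) < ℓ / 2 :=
    hlim.eventually (gt_mem_nhds (half_pos hwpos))
  obtain ⟨k, hk, hk1, hk2⟩ := (hbound.and_eventually (h1.and h2)).exists
  linarith [le_abs_self (D k)]

/-- **A non-trivial tame witness is EVENTUALLY unfrozen**: for every candidate lattice rate `μ > 0` and constant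
`C`, for all large `k` some admissible `(z, n)` violates `|corr_k(s, s ∘ τ_z; n)| ≤ C e^{-μ n}` — the correlation
length of the `s`-channel, in lattice units, DIVERGES along the full sequence of the witness's couplings (not merely
along a subsequence). [folklore] -/
theorem eventually_unfrozen_of_isNontrivial (r : LatticeRep G) (sch : SpeciesScheme (YMSpecies G))
    (s : YMSpecies G) (T : OSData (YMSpecies G) 4) (hYM : IsYangMillsFor r sch T) (hnt : T.IsNontrivial s)
    (hc : ∀ ε : ℝ, 0 < ε → ∀ᶠ k in atTop, |sch.c s k| ≤ Real.exp (ε * (sch.a k)⁻¹)) {μ : ℝ} (hμ : 0 < μ)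
    (C : ℝ) :
    ∀ᶠ k in atTop, ∃ (z : Site 4) (n : ℕ), z 0 = 0 ∧ n ≤ sch.L k ∧
      C * Real.exp (-(μ * n)) <
        |latticeConnectedCorr r.ρ (sch.β k) (2 * sch.L k + 1) s.F (s.F ∘ configShift z) n| := by
  by_contra hnot
  rw [Filter.not_eventually] at hnot
  refine not_isNontrivial_of_frequently_frozenXi r sch s T hYM ⟨μ, C, hμ, ?_⟩ hc hnt
  refine hnot.mono fun k hk z n hz hn => ?_
  by_contra hlt
  push Not at hlt
  exact hk ⟨z, n, hz, hn, hlt⟩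

/-- **The crux BY NAME, sharpened**: at every compact simple `G` carrying the hypothesis of
`SmallCircleAnchor.ContinuumLegGivenGap`, the witness the crux returns has `β_k → ∞`, is tied to the lattice and
non-trivial in the curvature, and — if tamely renormalised — its curvature correlation length in lattice units
diverges along the FULL sequence `β_k` (every frozen bound fails for all large `k`): sequential criticality at the
witness's couplings, the scheme-level form of `DirichletWindow.XiDiverges`, is content of the crux. [folklore] -/
theorem continuumLegGivenGap_witness_xi_diverges
    (h : Summit.QuantumFields.YangMills.Theses.SmallCircleAnchor.ContinuumLegGivenGap) :
    ∀ (G : Type) [Group G] [TopologicalSpace G] [IsTopologicalGroup G] [CompactSpace G],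
      IsCompactSimpleLieGroup G → letI : MeasurableSpace G := borel G; haveI : BorelSpace G := ⟨rfl⟩;
      (∀ r : LatticeRep G, ∃ β₀ : ℝ, ∀ β : ℝ, β₀ ≤ β → ∃ m : ℝ, 0 < m ∧ ∃ S₁ : ℕ,
          ∀ A B : YMSpecies G, ∃ C : ℝ, ∀ S n : ℕ, S₁ ≤ S → n ≤ S →
            |latticeConnectedCorr r.ρ β (2 * S + 1) A.F B.F n| ≤ C * Real.exp (-(m * n))) →
        ∃ (r : LatticeRep G) (sch : SpeciesScheme (YMSpecies G)) (T : OSData (YMSpecies G) 4),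
          sch.HasWeakCouplingLimit ∧ IsYangMillsFor r sch T ∧ T.IsNontrivial r.curvature ∧
            ((∀ ε : ℝ, 0 < ε → ∀ᶠ k in atTop, |sch.c r.curvature k| ≤ Real.exp (ε * (sch.a k)⁻¹)) →
              ∀ (μ C : ℝ), 0 < μ → ∀ᶠ k in atTop, ∃ (z : Site 4) (n : ℕ), z 0 = 0 ∧ n ≤ sch.L k ∧
                C * Real.exp (-(μ * n)) <
                  |latticeConnectedCorr r.ρ (sch.β k) (2 * sch.L k + 1) r.curvature.F
                      (r.curvature.F ∘ configShift z) n|) := by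
  intro G _ _ _ _ hG
  letI : MeasurableSpace G := borel G
  haveI : BorelSpace G := ⟨rfl⟩
  intro hgap
  obtain ⟨r, sch, T, hw, hYM, hnt, -, -⟩ := h G hG hgap
  exact ⟨r, sch, T, hw, hYM, hnt, fun hc μ C hμ =>
    eventually_unfrozen_of_isNontrivial r sch r.curvature T hYM hnt hc hμ C⟩

end Subsequence

end Summit.QuantumFields.YangMills.Theorems.ContinuumLegGivenGap.Negative

end
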